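import Mathlib

/-!
# T5HalfPlaneHolomorphy — the parameter integral `s ↦ ∫ c(g) a(g)^s dμ` is holomorphic on the
half-plane where it converges absolutely, kernel-checked

Support for `route/T5-N4-p5.md` (sub-step N4.3 = (R3)), step (N4.3.P1): «for general `s` the standard
section is `Φ_s(x) = Φ_{1/2}(x) · |a(x)|^{s − 1/2}` … with `Δ(g)^{ε/2} = (cosh t)^ε` and
`∫ (cosh t)^ε cosh(t)^{−6} sinh(2t) dt < ∞` for `ε < 4`, the integral converges absolutely on the OPEN
set `Re s > 1/2 − ε` and is holomorphic there (dominated convergence)».  The row «dominated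
convergence / holomorphy» was the one [A] (standard analysis) row of the kernel-coverage map
`T5-SUPPORT-p1.md` S4.  This file supplies it in abstract form, for ANY measure space:

* the integrand `c(g) · (a g : ℂ)^s` with `0 < a ≤ 1` (in (P1): `a = |a(i(g,1))| = Δ(g)^{−1/2}`,
  `c = Φ_{1/2} · \overline{⟨π(g)f, f⟩}`), and the single hypothesis
  `∫ ‖c(g)‖ a(g)^{−ε} dμ < ∞` (in (P1): the `ε`-bound of row L3);
* `integrable_integrand`: absolute convergence on the closed half-plane `Re s ≥ −ε`;
* `hasDerivAt_integral` / `differentiableOn_integral`: the integral is complex-differentiable at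
  every `s₀` with `Re s₀ > −ε`, with derivative `∫ c(g) a(g)^{s₀} log a(g) dμ` — Mathlib's
  `hasDerivAt_integral_of_dominated_loc_of_deriv_le` with the dominating function
  `δ⁻¹ ‖c‖ a^{−ε}` on the ball of radius `δ = (Re s₀ + ε)/2` (the elementary bound
  `|log a| · a^δ ≤ 1/δ`, `abs_log_mul_rpow_le`);
* `differentiableOn_integral_shift`: the same for `s ↦ ∫ c(g) a(g)^{s − 1/2} dμ` on `Re s > 1/2 − ε`
  — the shape of (P1).

Honest scope: the integrand's identification (`Φ_s` as the standard section, `|a(i(g,1))|` as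
`Δ^{−1/2}`, `c` as the product of the two matrix coefficients) is the text's; this file takes `c`
and `a` as arbitrary measurable data.
-/

noncomputable section

namespace Summit.Ventures.HodgeRepro2.T5HalfPlaneHolomorphy

open MeasureTheory Complex Set Filter Metric

variable {G : Type*} [MeasurableSpace G] {μ : Measure G}

/-- `|log a| · a^δ ≤ 1/δ` for `0 < a ≤ 1` and `δ > 0` (from `log x ≤ x − 1` at `x = a^{−δ}`). -/
theorem abs_log_mul_rpow_le {a δ : ℝ} (ha0 : 0 < a) (ha1 : a ≤ 1) (hδ : 0 < δ) :
    |Real.log a| * a ^ δ ≤ 1 / δ := by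
  have hlog : Real.log a ≤ 0 := Real.log_nonpos ha0.le ha1
  rw [abs_of_nonpos hlog]
  have hpos : 0 < a ^ δ := Real.rpow_pos_of_pos ha0 δ
  have h1 : Real.log (a ^ (-δ)) ≤ a ^ (-δ) - 1 :=
    Real.log_le_sub_one_of_pos (Real.rpow_pos_of_pos ha0 _)
  rw [Real.log_rpow ha0, Real.rpow_neg ha0.le] at h1
  -- `h1 : -δ * log a ≤ (a^δ)⁻¹ - 1`
  have h2 : (-δ * Real.log a) * a ^ δ ≤ ((a ^ δ)⁻¹ - 1) * a ^ δ :=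
    mul_le_mul_of_nonneg_right h1 hpos.le
  rw [sub_mul, inv_mul_cancel₀ hpos.ne'] at h2
  rw [le_div_iff₀ hδ]
  nlinarith [hpos]

omit [MeasurableSpace G] in
/-- `‖c · a^s‖ = ‖c‖ · a^{Re s}` for `a > 0`. -/
theorem norm_integrand (c : G → ℂ) (a : G → ℝ) (ha0 : ∀ g, 0 < a g) (s : ℂ) (g : G) :
    ‖c g * (a g : ℂ) ^ s‖ = ‖c g‖ * a g ^ s.re := by
  rw [norm_mul, Complex.norm_cpow_eq_rpow_re_of_pos (ha0 g)]

omit [MeasurableSpace G] in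
/-- Domination on the closed half-plane `Re s ≥ −ε`: `‖c a^s‖ ≤ ‖c‖ a^{−ε}` (as `a ≤ 1`). -/
theorem norm_integrand_le (c : G → ℂ) (a : G → ℝ) (ha0 : ∀ g, 0 < a g) (ha1 : ∀ g, a g ≤ 1)
    {ε : ℝ} {s : ℂ} (hs : -ε ≤ s.re) (g : G) :
    ‖c g * (a g : ℂ) ^ s‖ ≤ ‖c g‖ * a g ^ (-ε) := by
  rw [norm_integrand c a ha0]
  exact mul_le_mul_of_nonneg_left (Real.rpow_le_rpow_of_exponent_ge (ha0 g) (ha1 g) hs)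
    (norm_nonneg _)

/-- The integrand is measurable. -/
theorem aestronglyMeasurable_integrand {c : G → ℂ} {a : G → ℝ} (hc : AEStronglyMeasurable c μ)
    (ha : Measurable a) (s : ℂ) :
    AEStronglyMeasurable (fun g => c g * (a g : ℂ) ^ s) μ :=
  hc.mul ((Complex.measurable_ofReal.comp ha).pow_const s).aestronglyMeasurable

/-- ABSOLUTE CONVERGENCE on the closed half-plane `Re s ≥ −ε`, from `∫ ‖c‖ a^{−ε} < ∞`. -/
theorem integrable_integrand {c : G → ℂ} {a : G → ℝ} (hc : AEStronglyMeasurable c μ)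
    (ha : Measurable a) (ha0 : ∀ g, 0 < a g) (ha1 : ∀ g, a g ≤ 1) {ε : ℝ}
    (hint : Integrable (fun g => ‖c g‖ * a g ^ (-ε)) μ) {s : ℂ} (hs : -ε ≤ s.re) :
    Integrable (fun g => c g * (a g : ℂ) ^ s) μ :=
  hint.mono' (aestronglyMeasurable_integrand hc ha s)
    (ae_of_all _ (fun g => norm_integrand_le c a ha0 ha1 hs g))

omit [MeasurableSpace G] in
/-- The derivative of the integrand in `s`: `c · a^s · log a`. -/
theorem hasDerivAt_integrand (c : G → ℂ) (a : G → ℝ) (ha0 : ∀ g, 0 < a g) (g : G) (s : ℂ) :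
    HasDerivAt (fun s : ℂ => c g * (a g : ℂ) ^ s)
      (c g * ((a g : ℂ) ^ s * (Real.log (a g) : ℂ))) s := by
  have hne : (a g : ℂ) ≠ 0 := by exact_mod_cast (ha0 g).ne'
  have h := (hasDerivAt_id s).const_cpow (c := (a g : ℂ)) (Or.inl hne)
  simp only [id, mul_one] at h
  have h' := h.const_mul (c g)
  rwa [← Complex.ofReal_log (ha0 g).le] at h'

omit [MeasurableSpace G] in
/-- The bound on the derivative: for `Re s ≥ −ε + δ`,
`‖c a^s log a‖ ≤ δ⁻¹ ‖c‖ a^{−ε}`. -/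
theorem norm_deriv_le (c : G → ℂ) (a : G → ℝ) (ha0 : ∀ g, 0 < a g) (ha1 : ∀ g, a g ≤ 1)
    {ε δ : ℝ} (hδ : 0 < δ) {s : ℂ} (hs : -ε + δ ≤ s.re) (g : G) :
    ‖c g * ((a g : ℂ) ^ s * (Real.log (a g) : ℂ))‖ ≤ (1 / δ) * (‖c g‖ * a g ^ (-ε)) := by
  rw [norm_mul, norm_mul, Complex.norm_cpow_eq_rpow_re_of_pos (ha0 g), Complex.norm_real,
    Real.norm_eq_abs]
  have h1 : a g ^ s.re ≤ a g ^ (-ε + δ) :=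
    Real.rpow_le_rpow_of_exponent_ge (ha0 g) (ha1 g) hs
  have h2 : a g ^ (-ε + δ) = a g ^ (-ε) * a g ^ δ := Real.rpow_add (ha0 g) _ _
  have h3 := abs_log_mul_rpow_le (ha0 g) (ha1 g) hδ
  have hc0 : 0 ≤ ‖c g‖ := norm_nonneg _
  have hae : 0 ≤ a g ^ (-ε) := Real.rpow_nonneg (ha0 g).le _
  have hl0 : 0 ≤ |Real.log (a g)| := abs_nonneg _
  calc ‖c g‖ * (a g ^ s.re * |Real.log (a g)|)
      ≤ ‖c g‖ * (a g ^ (-ε) * a g ^ δ * |Real.log (a g)|) := by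
        rw [← h2]
        exact mul_le_mul_of_nonneg_left (mul_le_mul_of_nonneg_right h1 hl0) hc0
    _ = ‖c g‖ * a g ^ (-ε) * (|Real.log (a g)| * a g ^ δ) := by ring
    _ ≤ ‖c g‖ * a g ^ (-ε) * (1 / δ) :=
        mul_le_mul_of_nonneg_left h3 (mul_nonneg hc0 hae)
    _ = (1 / δ) * (‖c g‖ * a g ^ (-ε)) := by ring

/-- HOLOMORPHY: at every `s₀` with `Re s₀ > −ε` the integral `s ↦ ∫ c(g) a(g)^s dμ` is
complex-differentiable, with derivative `∫ c(g) a(g)^{s₀} log a(g) dμ` (dominated convergence on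
the ball of radius `δ = (Re s₀ + ε)/2`). -/
theorem hasDerivAt_integral {c : G → ℂ} {a : G → ℝ} (hc : AEStronglyMeasurable c μ)
    (ha : Measurable a) (ha0 : ∀ g, 0 < a g) (ha1 : ∀ g, a g ≤ 1) {ε : ℝ}
    (hint : Integrable (fun g => ‖c g‖ * a g ^ (-ε)) μ) {s₀ : ℂ} (hs₀ : -ε < s₀.re) :
    HasDerivAt (fun s : ℂ => ∫ g, c g * (a g : ℂ) ^ s ∂μ)
      (∫ g, c g * ((a g : ℂ) ^ s₀ * (Real.log (a g) : ℂ)) ∂μ) s₀ := by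
  set δ : ℝ := (s₀.re + ε) / 2 with hδ
  have hδpos : 0 < δ := by rw [hδ]; linarith
  have hmeas' : AEStronglyMeasurable (fun g => c g * ((a g : ℂ) ^ s₀ * (Real.log (a g) : ℂ))) μ :=
    hc.mul (((Complex.measurable_ofReal.comp ha).pow_const s₀).mul
      (Complex.measurable_ofReal.comp (Real.measurable_log.comp ha))).aestronglyMeasurable
  have hbound : ∀ᵐ g ∂μ, ∀ x ∈ ball s₀ δ,
      ‖c g * ((a g : ℂ) ^ x * (Real.log (a g) : ℂ))‖ ≤ (1 / δ) * (‖c g‖ * a g ^ (-ε)) := by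
    refine ae_of_all _ (fun g x hx => norm_deriv_le c a ha0 ha1 hδpos ?_ g)
    rw [mem_ball, Complex.dist_eq] at hx
    have h1 : |(x - s₀).re| ≤ ‖x - s₀‖ := Complex.abs_re_le_norm _
    rw [Complex.sub_re] at h1
    have h2 := (abs_sub_le_iff.mp (h1.trans hx.le)).2
    rw [hδ] at h2 ⊢
    linarith
  have key := hasDerivAt_integral_of_dominated_loc_of_deriv_le (μ := μ)
    (F := fun s g => c g * (a g : ℂ) ^ s)
    (F' := fun s g => c g * ((a g : ℂ) ^ s * (Real.log (a g) : ℂ)))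
    (bound := fun g => (1 / δ) * (‖c g‖ * a g ^ (-ε)))
    (ball_mem_nhds s₀ hδpos)
    (Eventually.of_forall (fun x => aestronglyMeasurable_integrand hc ha x))
    (integrable_integrand hc ha ha0 ha1 hint hs₀.le)
    hmeas' hbound (hint.const_mul (1 / δ))
    (ae_of_all _ (fun g x _ => hasDerivAt_integrand c a ha0 g x))
  exact key.2

/-- The integral is holomorphic on the open half-plane `{Re s > −ε}`. -/
theorem differentiableOn_integral {c : G → ℂ} {a : G → ℝ} (hc : AEStronglyMeasurable c μ)
    (ha : Measurable a) (ha0 : ∀ g, 0 < a g) (ha1 : ∀ g, a g ≤ 1) {ε : ℝ}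
    (hint : Integrable (fun g => ‖c g‖ * a g ^ (-ε)) μ) :
    DifferentiableOn ℂ (fun s : ℂ => ∫ g, c g * (a g : ℂ) ^ s ∂μ) {s : ℂ | -ε < s.re} :=
  fun _ hs => (hasDerivAt_integral hc ha ha0 ha1 hint hs).differentiableAt.differentiableWithinAt

/-- THE SHAPE OF (N4.3.P1): `s ↦ ∫ c(g) a(g)^{s − 1/2} dμ` is holomorphic on `{Re s > 1/2 − ε}`
(absolute convergence on `Re s ≥ 1/2 − ε` by `integrable_integrand`). -/
theorem differentiableOn_integral_shift {c : G → ℂ} {a : G → ℝ} (hc : AEStronglyMeasurable c μ)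
    (ha : Measurable a) (ha0 : ∀ g, 0 < a g) (ha1 : ∀ g, a g ≤ 1) {ε : ℝ}
    (hint : Integrable (fun g => ‖c g‖ * a g ^ (-ε)) μ) :
    DifferentiableOn ℂ (fun s : ℂ => ∫ g, c g * (a g : ℂ) ^ (s - 1 / 2) ∂μ)
      {s : ℂ | 1 / 2 - ε < s.re} := by
  intro s hs
  have hs' : -ε < (s - 1 / 2).re := by
    simp only [Complex.sub_re, Complex.div_ofNat_re, Complex.one_re] at hs ⊢
    simp only [mem_setOf_eq] at hs
    linarith
  have h := (hasDerivAt_integral hc ha ha0 ha1 hint hs').differentiableAt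
  have h2 : DifferentiableAt ℂ (fun s : ℂ => s - 1 / 2) s := (differentiableAt_id.sub_const _)
  exact (h.comp s h2).differentiableWithinAt

end Summit.Ventures.HodgeRepro2.T5HalfPlaneHolomorphy

end
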